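import Mathlib
import Literature.Analysis.FluidPDE.SelfSimilar
import Literature.Analysis.FluidPDE.VectorCalculus
import Literature.Analysis.FluidPDE.AxisymmetricEuler
import Literature.Analysis.FluidPDE.SteadyLiouvilleCriteria
import HarnessLib

/-!
# Liouville theorems for steady Navier–Stokes `D`-solutions on `ℝ³` — named facts

The **Liouville problem for steady `D`-solutions** (Leray 1933; Galdi 2011, §I.2, p. 12, third
open problem; Tsai 2018, Conj. 2.5; Wang 2025, (0.1)–(0.3); Wang–Yang 2026, §1.1: "remains
open, even for axisymmetric `D`-solutions"): is every smooth solution of the stationary system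

  `−Δu + (u·∇)u + ∇p = 0`, `div u = 0` on `ℝ³`          (Wang 2025, (0.1); viscosity `ν = 1`)

with `u(x) → 0` as `|x| → ∞` (0.2) and finite Dirichlet integral `∫ |∇u|² < ∞` (0.3) identically
zero?  This file vendors, as named facts (`def … : Prop`, D-0014), the printed partial answers that
the route `Summit.NavierStokesRegularity.NavierStokesRegularity.Theses.GaldiLiouvilleGate` consumes
(items `GaldiLiouville`, `AxisymGaldiLiouville`, `CriticalRateLiouville`), and records the open
problem itself as a `Prop` (`SteadyDSolutionLiouvilleProblem`, never asserted; its docstring starts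
`OPEN CONJECTURE —` and carries `[status: open]`: an open statement, not literature debt — no
`SteadyDSolutionLiouvilleProblem_holds` can exist short of settling the problem).

* `SteadyDSolutionLiouvilleProblem` — the open problem (0.1)–(0.3) ⇒ `u ≡ 0` (Wang 2025, p. 1).
* `sereginWang_liouville_L3_annulus` — Seregin–Wang's annular criterion at Galdi's critical rate
  `2/3`, case `q = ℓ = 3`: with `M(R) = R^{-1/3} ‖u‖_{L³(B_R ∖ B_{R/2})}`, `lim inf M < ∞` forces
  `D(u) = ∫|∇u|² ≤ c (lim inf M)³`, and `(lim inf M)³ ≤ δ D(u)` with `δ` small forces `u ≡ 0`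
  (Seregin–Wang 2019/2020, Thm 1.1; as printed in Wang 2025, Thm 2.4 (i) and Remark 2.3 (3)).
* `wangYang2026_liouville_velocity_log`, `wangYang2026_liouville_vorticity_log` — Wang–Yang 2026,
  Thm 1.5 / Thm 1.6: a `D`-solution with `sup_{|x'|=r} |u| ≤ C r^{-2/3} [log(e+r)]^{-γ}` (resp.
  `sup_{|x'|=r} |ω| ≤ C r^{-5/3} [log(e+r)]^{-γ}`) for `r ≥ 1` and some `γ > 1/3` vanishes — the
  printed state of the art at the critical rates `2/3` (velocity) and `5/3` (vorticity), one
  logarithm short of the plain rate with an arbitrary constant.  The velocity statement is REDUCED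
  IN THE TREE to `sereginWang_liouville_L3_annulus`
  (`wangYang2026_liouville_velocity_log_of_sereginWang`, file `SteadyNSLiouvilleProofs.lean`, which
  proves `M(R) → 0` under (1.13), Wang–Yang's (4.8)–(4.11)); it is kept here as the `Prop` that file
  concludes.
* Proved links: `sereginWangL3_eq_annularMorrey_three` (the quantity here is the `q = 3` value of
  `annularMorrey` of `SteadyLiouvilleCriteria.lean`), `sereginWang_liouville_L3_annulus.of_liminf_eq_zero`
  (the `lim inf = 0` consequence, Wang 2025, Remark 2.3 (3)), and the sanity links at the end.

Galdi's `L^{9/2}` criterion (Galdi 2011, Thm X.9.5), Seregin–Wang's criterion for `q > 3` and the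
Korobkov–Pileckas–Russo no-swirl theorem are the named facts `galdi_liouville_nineHalves`,
`SereginWang2020_annular_liouville`, `KorobkovPileckasRusso2015_liouville_noSwirl` of the sibling file
`SteadyLiouvilleCriteria.lean` (stated for every viscosity `ν > 0`), which this file imports.

## Revision note

Rev. 3: the first revision of this file (landed concurrently with `SteadyLiouvilleCriteria.lean`)
also carried `ν = 1` renderings `galdi_liouville_L9half` and `kpr_liouville_axisymmetric_noSwirl` of
Galdi's and KPR's theorems; they duplicated the sibling's `galdi_liouville_nineHalves` /
`KorobkovPileckasRusso2015_liouville_noSwirl` (instances at `ν = 1`), had no dependents, and are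
removed together with their two sanity links.  Everything referenced by
`SteadyNSLiouvilleProofs.lean` (`sereginWangL3`, `sereginWang_liouville_L3_annulus`,
`wangYang2026_liouville_velocity_log`) is unchanged.

## Rendering

Physical space `ℝ³ = EuclideanSpace ℝ (Fin 3)`.  "Smooth solution of (0.1)" is the tree's pointwise
profile class at rate `a = 0` and viscosity `ν = 1`, `IsLerayProfile 1 0 u p` (`SelfSimilar.lean`:
`−νΔU + aU + a(y·∇)U + (U·∇)U + ∇P = 0`, `div U = 0`, `U ∈ C²`, `P ∈ C¹`), plus `C^∞` smoothness
of `u` and `p` as in print.  All facts are stated with `ν = 1` exactly as printed; for viscosity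
`ν > 0` apply them to `(ν⁻¹ u, ν⁻² p)`.  The Dirichlet integral is
`∫⁻ x, ENNReal.ofReal (frobeniusNormSq (fderiv ℝ u x))` (`VectorCalculus.frobeniusNormSq`,
`|∇u|² = ∑ᵢⱼ (∂ⱼuᵢ)²`), literally the expression used by the route items; decay at infinity is
`Tendsto u (cocompact ℝ³) (𝓝 0)`; axisymmetry / no swirl / the distance to the axis are the tree's
`IsAxisymmetric`, `HasNoSwirl`, `cylRadius` (`AxisymmetricEuler.lean`, axis = `x 2`); the
vorticity is `curl` (`VectorCalculus.lean`).  `lim inf` over `R → ∞` is Mathlib's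
`Filter.liminf … atTop` in the complete lattice `ℝ≥0∞` (no real-valued junk).

## Not here

Chae 2014 (`Δu ∈ L^{6/5}`), Chae–Wolf 2016 (log-improved `L^{9/2}`), Seregin 2016 (`u ∈ BMO⁻¹`),
Kozono–Terasawa–Wakasugi 2017 (`|ω| = o(|x|^{-5/3})`, small weak-`L^{9/2}`), Tsai 2021, Thm 1.1
(little-`o` annular `L^q` criteria, `12/5 ≤ q ≤ 3`), Cho–Yang 2026 (growth functions, `p < 3`),
Chae 2026 (head-pressure lower bounds): cited in `references.bib` / the docstrings only.
-/

namespace Literature.Analysis.FluidPDE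

open _root_.MeasureTheory _root_.Filter _root_.Set
open scoped ENNReal NNReal Topology

/-- Local notation for physical space `ℝ³ = EuclideanSpace ℝ (Fin 3)`. -/
local notation "ℝ³" => EuclideanSpace ℝ (Fin 3)

/-- OPEN CONJECTURE — **the Liouville problem for steady `D`-solutions** (a `Prop`, never
asserted), posed as open by Galdi 2011, §I.2 (p. 12, third open problem) and Remark X.9.4, by
Tsai 2018, Conj. 2.5 (p. 23, "Liouville problem"), by Wang 2025, preface p. 1 (system (0.1) with
(0.2), (0.3): "is `u = 0` the only solution? this seemingly simple question is an open problem
(公开问题) that many mathematicians have studied in the last decade or so") and by Wang–Yang 2026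
(arXiv:2608.06040, abstract and p. 2: "The Liouville problem for the three-dimensional stationary
Navier–Stokes equations remains open, even for axisymmetric `D`-solutions") [status: open]:
every smooth solution `(u, p)` of
`−Δu + (u·∇)u + ∇p = 0`, `div u = 0` on `ℝ³` (Wang 2025, (0.1)) with `u(x) → 0` as `|x| → ∞` (0.2)
and `∫_{ℝ³} |∇u|² dx < ∞` (0.3) is identically zero.

Status: open (2026-08) — no proof and no counterexample is in print; the printed partial answers
are the named facts of this file (`sereginWang_liouville_L3_annulus`,
`wangYang2026_liouville_velocity_log`, `wangYang2026_liouville_vorticity_log`), of the sibling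
`SteadyLiouvilleCriteria.lean` (`galdi_liouville_nineHalves`, `SereginWang2020_annular_liouville`,
`KorobkovPileckasRusso2015_liouville_noSwirl`) and the criteria listed under "Not here" in the
module docstring.  Not literature debt: no `SteadyDSolutionLiouvilleProblem_holds` can exist short of
settling the problem.  The `ν = 1` case of the route item
`Summit.NavierStokesRegularity.NavierStokesRegularity.Theses.GaldiLiouvilleGate.GaldiLiouville`.
[cite: Wang2025, (0.1)–(0.3), p. 1] -/
def SteadyDSolutionLiouvilleProblem : Prop :=
  ∀ (u : ℝ³ → ℝ³) (p : ℝ³ → ℝ), IsLerayProfile 1 0 u p →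
    ContDiff ℝ (⊤ : ℕ∞) u → ContDiff ℝ (⊤ : ℕ∞) p →
    (∫⁻ x, ENNReal.ofReal (frobeniusNormSq (fderiv ℝ u x))) < ∞ →
    Tendsto u (cocompact ℝ³) (𝓝 0) → u = 0

/-- Seregin–Wang's annular quantity at Galdi's critical rate, case `q = ℓ = 3` (Seregin–Wang 2020,
Thm 1.1; Wang 2025, §2.3.3: `M_{γ,q,ℓ}(R) = R^{γ − 3/q} ‖u‖_{L^{q,ℓ}(B_R ∖ B_{R/2})}` with
`γ = 2/3`, `q = ℓ = 3`, i.e. `M(R) = R^{-1/3} ‖u‖_{L³(B_R ∖ B_{R/2})}`), valued in `ℝ≥0∞`; the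
annulus is `{R/2 ≤ |x| < R}` (`B(R)` the open ball). [cite: SereginWang2020, Thm 1.1] -/
noncomputable def sereginWangL3 (u : ℝ³ → ℝ³) (R : ℝ) : ℝ≥0∞ :=
  ENNReal.ofReal (R ^ (-(1 / 3 : ℝ))) *
    eLpNorm u 3 (volume.restrict {x : ℝ³ | R / 2 ≤ ‖x‖ ∧ ‖x‖ < R})

/-- **Seregin–Wang's annular Liouville criterion at the critical rate `2/3`** (Seregin–Wang,
Algebra i Analiz 31 (2019) / St. Petersburg Math. J. 31 (2020), Thm 1.1, case `q = ℓ = 3`; printed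
as Wang 2025, Thm 2.4 (i)): there are universal constants `c` and `δ > 0` such that for every smooth
solution `(u, p)` of `−Δu + (u·∇)u + ∇p = 0`, `div u = 0` on `ℝ³` (NO decay or finite-Dirichlet
hypothesis) with `L := lim inf_{R→∞} R^{-1/3} ‖u‖_{L³(B_R∖B_{R/2})} < ∞`:
(2.13) the Dirichlet integral is finite, `D(u) = ∫|∇u|² ≤ c L³`; and (2.14) if moreover
`L³ ≤ δ D(u)` then `u ≡ 0` (printed: "for some `0 < δ < 1/c`").  Consequences printed as Wang 2025,
Remark 2.3: `u ≡ 0` whenever `lim inf_{R→∞} R^{-1/3}‖u‖_{L³(B_R∖B_{R/2})} = 0` (also Tsai 2021,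
Thm 1.1 (a), `δ = 0`), or `u ∈ L^{9/2,∞}` with vanishing annular norms.  At the pointwise rate
`|u(x)| ≤ C|x|^{-2/3}` one has `M(R) ≤ (2π)^{1/3} C` bounded, so (2.13) gives `D(u) < ∞` for free
and (2.14) gives `u ≡ 0` for SMALL `C` only — the arbitrary-`C` statement is route item
`Summit.NavierStokesRegularity.NavierStokesRegularity.Theses.GaldiLiouvilleGate.CriticalRateLiouville`,
not in print (Wang 2025, Ch. 3 intro: only `|u| ≤ C|x|^{-2/3+}`; Wang–Yang 2026, Thm 1.5: one
logarithm short). [cite: SereginWang2020, Thm 1.1] -/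
def sereginWang_liouville_L3_annulus : Prop :=
  ∃ c δ : ℝ≥0, 0 < δ ∧ ∀ (u : ℝ³ → ℝ³) (p : ℝ³ → ℝ), IsLerayProfile 1 0 u p →
    ContDiff ℝ (⊤ : ℕ∞) u → ContDiff ℝ (⊤ : ℕ∞) p →
    liminf (sereginWangL3 u) atTop < ∞ →
      (∫⁻ x, ENNReal.ofReal (frobeniusNormSq (fderiv ℝ u x))) ≤
          c * (liminf (sereginWangL3 u) atTop) ^ 3 ∧
      ((liminf (sereginWangL3 u) atTop) ^ 3 ≤
          δ * ∫⁻ x, ENNReal.ofReal (frobeniusNormSq (fderiv ℝ u x)) → u = 0)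

/-- The quantity `sereginWangL3` is the `q = 3` value of the sibling file's `annularMorrey`:
`R^{-1/3} ‖u‖_{L³(B_R ∖ B_{R/2})} = R^{2/3 − 3/3} (∫_{B_R∖B_{R/2}} |u|³)^{1/3}` (unfold the `L³`
seminorm; the set `{R/2 ≤ |x| < R}` is `ball 0 R ∖ ball 0 (R/2)`). [folklore] -/
theorem sereginWangL3_eq_annularMorrey_three (u : ℝ³ → ℝ³) (R : ℝ) :
    sereginWangL3 u R = annularMorrey 3 u R := by
  have h3 : (3 : ℝ≥0∞).toReal = 3 := by norm_num
  have hset : {x : ℝ³ | R / 2 ≤ ‖x‖ ∧ ‖x‖ < R} = Metric.ball (0 : ℝ³) R \ Metric.ball 0 (R / 2) := by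
    ext x
    simp only [mem_setOf_eq, Set.mem_sdiff, Metric.mem_ball, dist_zero_right, not_lt]
    tauto
  rw [sereginWangL3, annularMorrey, eLpNorm_eq_lintegral_rpow_enorm_toReal (by norm_num) (by norm_num),
    h3, hset]
  norm_num

/-- Under Seregin–Wang's theorem, a smooth steady solution whose annular quantity has
`lim inf = 0` (e.g. `u ∈ L^{9/2}`, or `|u| = o(|x|^{-2/3})`, or — `SteadyNSLiouvilleProofs.lean` —
the Wang–Yang hypothesis (1.13) with `u → 0`) is trivial: the smallness clause (2.14) holds since its
left side vanishes (Wang 2025, Remark 2.3 (3); Tsai 2021, Thm 1.1 (a) with `δ = 0`).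
[cite: Wang2025, Remark 2.3 (3)] -/
theorem sereginWang_liouville_L3_annulus.of_liminf_eq_zero (h : sereginWang_liouville_L3_annulus)
    {u : ℝ³ → ℝ³} {p : ℝ³ → ℝ} (hprof : IsLerayProfile 1 0 u p)
    (hu : ContDiff ℝ (⊤ : ℕ∞) u) (hp : ContDiff ℝ (⊤ : ℕ∞) p)
    (h0 : liminf (sereginWangL3 u) atTop = 0) : u = 0 := by
  obtain ⟨c, δ, _, H⟩ := h
  have H' := H u p hprof hu hp (by rw [h0]; exact ENNReal.zero_lt_top)
  exact H'.2 (by rw [h0]; simp)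

/-- **Wang–Yang 2026, Thm 1.5 (log-improved velocity criterion at the critical rate `2/3`)**:
let `(u, p)` be a smooth solution of (1.1) = steady Navier–Stokes on `ℝ³` with `u → 0` at infinity,
satisfying (1.2) `∫|∇u|² < ∞`; if for some `γ > 1/3` and `C`,
`sup_{|x'| = r, z ∈ ℝ} |u(x', z)| ≤ C / (r^{2/3} [log(e + r)]^γ)` for all `r ≥ 1` (1.13) — here
`r = cylRadius x` is the distance to the (fixed, `x 2`-) axis and NO symmetry is assumed —, then
`u ≡ 0`.  Via Prop. 1.4 there (`∫₁^∞ r H(r)³ dr < ∞ ⇒ u ≡ 0`); improves Wang 2019 / Zhao 2019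
(`|u| = O(r^{-μ})`, `μ > 2/3`, axisymmetric).  arXiv:2608.06040, pp. 4, 20–21.  IN THE TREE this
statement is a consequence of `sereginWang_liouville_L3_annulus`
(`wangYang2026_liouville_velocity_log_of_sereginWang`, `SteadyNSLiouvilleProofs.lean`: under (1.13)
and `u → 0`, `sereginWangL3 u R → 0`, so Seregin–Wang's smallness clause is free); it is kept as the
`Prop` that theorem concludes. [cite: WangYang2026, Thm 1.5] -/
def wangYang2026_liouville_velocity_log : Prop :=
  ∀ (u : ℝ³ → ℝ³) (p : ℝ³ → ℝ), IsLerayProfile 1 0 u p →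
    ContDiff ℝ (⊤ : ℕ∞) u → ContDiff ℝ (⊤ : ℕ∞) p →
    (∫⁻ x, ENNReal.ofReal (frobeniusNormSq (fderiv ℝ u x))) < ∞ →
    Tendsto u (cocompact ℝ³) (𝓝 0) →
    (∃ C γ : ℝ, 1 / 3 < γ ∧ ∀ x : ℝ³, 1 ≤ cylRadius x →
      ‖u x‖ ≤ C / (cylRadius x ^ (2 / 3 : ℝ) * Real.log (Real.exp 1 + cylRadius x) ^ γ)) →
    u = 0

/-- **Wang–Yang 2026, Thm 1.6 (log-improved vorticity criterion at the critical rate `5/3`)**: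
let `(u, p)` be a smooth solution of (1.1) (steady Navier–Stokes on `ℝ³`, `u → 0` at infinity)
satisfying (1.2) `∫|∇u|² < ∞`, and `ω = curl u`; if for some `γ > 1/3` and `C`,
`sup_{|x'| = r, z ∈ ℝ} |ω(x', z)| ≤ C / (r^{5/3} [log(e + r)]^γ)` for all `r ≥ 1` (1.14), then
`u ≡ 0` (no symmetry assumed; compare Kozono–Terasawa–Wakasugi 2017, `|ω| = o(|x|^{-5/3})`, and
the axisymmetric `β > 5/3` criteria of Wang 2019 / Zhao 2019, Wang 2025, Thm 3.10).
arXiv:2608.06040, pp. 5, 21–22. [cite: WangYang2026, Thm 1.6] -/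
def wangYang2026_liouville_vorticity_log : Prop :=
  ∀ (u : ℝ³ → ℝ³) (p : ℝ³ → ℝ), IsLerayProfile 1 0 u p →
    ContDiff ℝ (⊤ : ℕ∞) u → ContDiff ℝ (⊤ : ℕ∞) p →
    (∫⁻ x, ENNReal.ofReal (frobeniusNormSq (fderiv ℝ u x))) < ∞ →
    Tendsto u (cocompact ℝ³) (𝓝 0) →
    (∃ C γ : ℝ, 1 / 3 < γ ∧ ∀ x : ℝ³, 1 ≤ cylRadius x →
      ‖curl u x‖ ≤ C / (cylRadius x ^ (5 / 3 : ℝ) * Real.log (Real.exp 1 + cylRadius x) ^ γ)) →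
    u = 0

/-! ## Elementary relations (proved) -/

/-- Wang–Yang's Thm 1.5 is a special case of the open problem. [folklore] -/
theorem wangYang2026_liouville_velocity_log_of_problem (h : SteadyDSolutionLiouvilleProblem) :
    wangYang2026_liouville_velocity_log :=
  fun u p hprof hu hp hD hlim _ => h u p hprof hu hp hD hlim

/-- The trivial solution satisfies every hypothesis of the open problem nonvacuously: `(0, 0)` is
a smooth steady solution with zero Dirichlet integral decaying at infinity (witnessing that the
hypotheses of `SteadyDSolutionLiouvilleProblem` are consistent). [folklore] -/
theorem steadyDSolution_hypotheses_zero :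
    IsLerayProfile 1 0 (0 : ℝ³ → ℝ³) (0 : ℝ³ → ℝ) ∧ ContDiff ℝ (⊤ : ℕ∞) (0 : ℝ³ → ℝ³) ∧
      ContDiff ℝ (⊤ : ℕ∞) (0 : ℝ³ → ℝ) ∧
      (∫⁻ x, ENNReal.ofReal (frobeniusNormSq (fderiv ℝ (0 : ℝ³ → ℝ³) x))) < ∞ ∧
      Tendsto (0 : ℝ³ → ℝ³) (cocompact ℝ³) (𝓝 0) := by
  refine ⟨IsLerayProfile.zero 1 0, contDiff_const, contDiff_const, ?_, tendsto_const_nhds⟩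
  simp [frobeniusNormSq]

end Literature.Analysis.FluidPDE
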